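import Summits.QuantumFields.QCD.Theses.NestedDissectionSea
import Summits.QuantumFields.QCD.Theses.QuarksAsStableAction

/-!
# Crux `LightQuarkCompletion` (stmt-QuantumFields-18066) — line `Sketch`: the WEAK NODE is the shared item
# `QuarksAsStableAction.ChiralCompletion` (stmt-QuantumFields-17394)

Kernel-checked bookkeeping for the planner (lead c1's helper C2, re-derived by lead c2, 2026-08-17).  The route's deciding
theorem `NestedDissectionSea.closes` consumes from the crux `LightQuarkCompletion` only three conjuncts of its conclusion — the
witness `reg'`'s `HasMassScaling`, `IsChiralAtZero` and the `QCDOf` body at every positive tuple, i.e. LITERALLY `QCDOf N_f`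
(`obtain ⟨reg', hms', -, -, -, hchi, hbody'⟩ := hL …; exact ⟨reg', hms', hchi, hbody'⟩`).  The refuter's crux-attack
(rattack-18066-0) flagged the remaining conjuncts (`HasAsymptoticScaling`, `m_crit' → 0`, the zero-threshold pin) as an
UNFORCED STRENGTHENING.  The WEAK NODE — crux hypotheses ⟹ `QCDOf N_f` — is supplied BY NAME by the sibling route's item
`QuarksAsStableAction.ChiralCompletion` (stmt-QuantumFields-17394: `∀ N_f ∈ {2,3}, (∃ M₀ ≥ 0, ∃ reg, HasMassScaling ∧ body
above M₀) → QCDOf N_f`), whose antecedent is the crux's own threshold body with the pins, the weak branch and asymptotic scaling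
forgotten:

* `qcdOf_of_chiralCompletion` — 17394 + (one threshold regularisation with mass scaling and the body above `M₀ ≥ 0`) ⟹ `QCDOf`;
* `weakNode_of_chiralCompletion` — 17394 ⟹ the crux with its conclusion weakened to `QCDOf N_f` (all hypotheses verbatim);
* `weakNode_of_lightQuarkCompletion` — the crux itself ⟹ the same weak node (projection, for comparison);
* `qcd_of_bridge_of_chiralCompletion` — the ALTERNATIVE DECIDING CHAIN: `RobustYangMillsRG → EarlyCrosserLaw →
  FrameAndSeparatorLaw → SeaFactorisationBridge → QuarksAsStableAction.ChiralCompletion → QCD`, i.e. binding 17394 in place of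
  18066 in `closes` loses nothing the route's other items supply.

Pure logic; no definition introduced; nothing here asserts a Theses decl unconditionally.
-/

noncomputable section

namespace Summit.QuantumFields.QCD.Theorems.LightQuarkJumpLine

open MeasureTheory Filter Topology
open Literature.MathematicalPhysics.QuantumFieldTheory Literature.MathematicalPhysics.QuantumLattice
  Literature.Probability.LatticeModels
open Summit.QuantumFields.QCD.Theses

/-- **`QCDOf` from the shared chiral-completion item and ONE threshold regularisation.**  If
`QuarksAsStableAction.ChiralCompletion` (stmt-QuantumFields-17394) holds, then any regularisation of `N_f ∈ {2,3}` with mass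
scaling carrying the `QCDOf` body above some threshold `M₀ ≥ 0` yields `QCDOf N_f`. [folklore] -/
theorem qcdOf_of_chiralCompletion (hC : QuarksAsStableAction.ChiralCompletion) {Nf : ℕ} (hNf : Nf = 2 ∨ Nf = 3)
    (reg : QCDRegularisation Nf) (hMS : reg.HasMassScaling) {M₀ : ℝ} (hM₀ : 0 ≤ M₀)
    (hbody : ∀ m : Fin Nf → ℝ, (∀ f, M₀ < m f) → ∃ (z shift : QCDField Nf → ℕ → ℝ) (T : OSData (QCDField Nf) 4),
      IsQCDAlong (reg.scheme m z shift) T ∧ T.IsNontrivial QCDField.glue ∧ T.IsNonGaussian QCDField.glue ∧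
        (∀ f g : Fin Nf, f ≠ g → T.IsNontrivial (QCDField.pseudoRe f g)) ∧
          ∃ Δ > 0, T.HasMassGap Δ ∧ (reg.scheme m z shift).HasLatticeMassGap Δ) :
    QCDOf Nf :=
  hC Nf hNf ⟨M₀, hM₀, reg, hMS, hbody⟩

/-- **The weak node from 17394.**  `QuarksAsStableAction.ChiralCompletion` implies the crux `LightQuarkCompletion` with its
conclusion WEAKENED to `QCDOf N_f` (hypotheses verbatim: both scalings, weak branch, `0 ≤ M₀`, two-sided pin above `M₀`, body
above `M₀`; only mass scaling, `0 ≤ M₀` and the body are used). [folklore] -/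
theorem weakNode_of_chiralCompletion (hC : QuarksAsStableAction.ChiralCompletion) :
    ∀ Nf : ℕ, (Nf = 2 ∨ Nf = 3) → ∀ reg : QCDRegularisation Nf, reg.HasMassScaling →
    (reg.scheme 0 0 0).HasAsymptoticScaling → (∀ᶠ k : ℕ in Filter.atTop, -1 ≤ reg.mcrit k) → ∀ M₀ : ℝ, 0 ≤ M₀ →
    (∀ m : Fin Nf → ℝ, (∀ f, M₀ < m f) → ∃ R : ℝ, 0 < R ∧ (∀ M : ℝ, M₀ < M → ∀ᶠ k : ℕ in Filter.atTop, ∀ S : ℕ,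
      R ≤ reg.a k * (2 * S + 1) → let N : ℕ := 2 * S + 1;
      let mq : Fin Nf → ℝ := fun f => reg.mcrit k + reg.a k * m f / reg.Zm k;
      let wt : GaugeConfig 4 N (Matrix.specialUnitaryGroup (Fin 3) ℂ) → ℝ :=
        fun U => ∏ f, ‖fermionDet (wilsonDirac (fundamentalRep (Fin 3)) U (mq f) 1)‖;
      (1 / 4 : ℝ) ≤ (∫ U, (if (fermionDet (wilsonDirac (fundamentalRep (Fin 3)) U
        (reg.mcrit k - reg.a k * M / reg.Zm k) 1)).re < 0 then (1 : ℝ) else 0) * wt U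
          ∂(wilsonMeasure (d := 4) (L := N) (fundamentalRep (Fin 3)) (reg.β k))) /
        (∫ U, wt U ∂(wilsonMeasure (d := 4) (L := N) (fundamentalRep (Fin 3)) (reg.β k)))) ∧
      (∀ M : ℝ, M₀ < M → ∀ᶠ k : ℕ in Filter.atTop, ∀ S : ℕ, R ≤ reg.a k * (2 * S + 1) →
        reg.a k * (2 * S + 1) ≤ 2 * R → let N : ℕ := 2 * S + 1;
        let mq : Fin Nf → ℝ := fun f => reg.mcrit k + reg.a k * m f / reg.Zm k;
        let wt : GaugeConfig 4 N (Matrix.specialUnitaryGroup (Fin 3) ℂ) → ℝ :=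
          fun U => ∏ f, ‖fermionDet (wilsonDirac (fundamentalRep (Fin 3)) U (mq f) 1)‖;
        (∫ U, (if (fermionDet (wilsonDirac (fundamentalRep (Fin 3)) U
          (reg.mcrit k + reg.a k * M / reg.Zm k) 1)).re < 0 then (1 : ℝ) else 0) * wt U
            ∂(wilsonMeasure (d := 4) (L := N) (fundamentalRep (Fin 3)) (reg.β k))) /
          (∫ U, wt U ∂(wilsonMeasure (d := 4) (L := N) (fundamentalRep (Fin 3)) (reg.β k))) ≤ (1 / 8 : ℝ))) →
    (∀ m : Fin Nf → ℝ, (∀ f, M₀ < m f) → ∃ (z shift : QCDField Nf → ℕ → ℝ) (T : OSData (QCDField Nf) 4),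
      IsQCDAlong (reg.scheme m z shift) T ∧ T.IsNontrivial QCDField.glue ∧ T.IsNonGaussian QCDField.glue ∧
        (∀ f g : Fin Nf, f ≠ g → T.IsNontrivial (QCDField.pseudoRe f g)) ∧
          ∃ Δ > 0, T.HasMassGap Δ ∧ (reg.scheme m z shift).HasLatticeMassGap Δ) →
    QCDOf Nf := by
  intro Nf hNf reg hMS _hAS _hbr M₀ hM₀ _hpin hbody
  exact qcdOf_of_chiralCompletion hC hNf reg hMS hM₀ hbody

/-- **The weak node from the crux itself** (projection of the conclusion: forget asymptotic scaling, `m_crit' → 0` and the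
zero-threshold pin — exactly what `NestedDissectionSea.closes` does). [folklore] -/
theorem weakNode_of_lightQuarkCompletion (hL : NestedDissectionSea.LightQuarkCompletion) :
    ∀ Nf : ℕ, (Nf = 2 ∨ Nf = 3) → ∀ reg : QCDRegularisation Nf, reg.HasMassScaling →
    (reg.scheme 0 0 0).HasAsymptoticScaling → (∀ᶠ k : ℕ in Filter.atTop, -1 ≤ reg.mcrit k) → ∀ M₀ : ℝ, 0 ≤ M₀ →
    (∀ m : Fin Nf → ℝ, (∀ f, M₀ < m f) → ∃ R : ℝ, 0 < R ∧ (∀ M : ℝ, M₀ < M → ∀ᶠ k : ℕ in Filter.atTop, ∀ S : ℕ,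
      R ≤ reg.a k * (2 * S + 1) → let N : ℕ := 2 * S + 1;
      let mq : Fin Nf → ℝ := fun f => reg.mcrit k + reg.a k * m f / reg.Zm k;
      let wt : GaugeConfig 4 N (Matrix.specialUnitaryGroup (Fin 3) ℂ) → ℝ :=
        fun U => ∏ f, ‖fermionDet (wilsonDirac (fundamentalRep (Fin 3)) U (mq f) 1)‖;
      (1 / 4 : ℝ) ≤ (∫ U, (if (fermionDet (wilsonDirac (fundamentalRep (Fin 3)) U
        (reg.mcrit k - reg.a k * M / reg.Zm k) 1)).re < 0 then (1 : ℝ) else 0) * wt U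
          ∂(wilsonMeasure (d := 4) (L := N) (fundamentalRep (Fin 3)) (reg.β k))) /
        (∫ U, wt U ∂(wilsonMeasure (d := 4) (L := N) (fundamentalRep (Fin 3)) (reg.β k)))) ∧
      (∀ M : ℝ, M₀ < M → ∀ᶠ k : ℕ in Filter.atTop, ∀ S : ℕ, R ≤ reg.a k * (2 * S + 1) →
        reg.a k * (2 * S + 1) ≤ 2 * R → let N : ℕ := 2 * S + 1;
        let mq : Fin Nf → ℝ := fun f => reg.mcrit k + reg.a k * m f / reg.Zm k;
        let wt : GaugeConfig 4 N (Matrix.specialUnitaryGroup (Fin 3) ℂ) → ℝ :=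
          fun U => ∏ f, ‖fermionDet (wilsonDirac (fundamentalRep (Fin 3)) U (mq f) 1)‖;
        (∫ U, (if (fermionDet (wilsonDirac (fundamentalRep (Fin 3)) U
          (reg.mcrit k + reg.a k * M / reg.Zm k) 1)).re < 0 then (1 : ℝ) else 0) * wt U
            ∂(wilsonMeasure (d := 4) (L := N) (fundamentalRep (Fin 3)) (reg.β k))) /
          (∫ U, wt U ∂(wilsonMeasure (d := 4) (L := N) (fundamentalRep (Fin 3)) (reg.β k))) ≤ (1 / 8 : ℝ))) →
    (∀ m : Fin Nf → ℝ, (∀ f, M₀ < m f) → ∃ (z shift : QCDField Nf → ℕ → ℝ) (T : OSData (QCDField Nf) 4),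
      IsQCDAlong (reg.scheme m z shift) T ∧ T.IsNontrivial QCDField.glue ∧ T.IsNonGaussian QCDField.glue ∧
        (∀ f g : Fin Nf, f ≠ g → T.IsNontrivial (QCDField.pseudoRe f g)) ∧
          ∃ Δ > 0, T.HasMassGap Δ ∧ (reg.scheme m z shift).HasLatticeMassGap Δ) →
    QCDOf Nf := by
  intro Nf hNf reg hMS hAS hbr M₀ hM₀ hpin hbody
  obtain ⟨reg', hms', -, -, -, hchi, hbody'⟩ := hL Nf hNf reg hMS hAS hbr M₀ hM₀ hpin hbody
  exact ⟨reg', hms', hchi, hbody'⟩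

/-- **The alternative deciding chain.**  Binding the shared item `QuarksAsStableAction.ChiralCompletion` (stmt-17394) in
place of `LightQuarkCompletion` in the route's `closes`: the bridge `SeaFactorisationBridge`, fed by name with
`RobustYangMillsRG`, `EarlyCrosserLaw` and `FrameAndSeparatorLaw`, returns for `N_f = 2, 3` a threshold regularisation with
mass scaling and the body above `M₀ ≥ 0`; 17394 turns it into `QCDOf N_f`; `QCD = QCDOf 2 ∧ QCDOf 3`.  Pure logic; every binder
used. [folklore] -/
theorem qcd_of_bridge_of_chiralCompletion :
    NestedDissectionSea.RobustYangMillsRG → NestedDissectionSea.EarlyCrosserLaw → NestedDissectionSea.FrameAndSeparatorLaw →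
    NestedDissectionSea.SeaFactorisationBridge → QuarksAsStableAction.ChiralCompletion → QCD := by
  intro hY hE hF hB hC
  have h := hB hY hE hF
  have key : ∀ Nf : ℕ, (Nf = 2 ∨ Nf = 3) → QCDOf Nf := by
    intro Nf hNf
    obtain ⟨reg, hms, -, -, M₀, hM₀, -, hbody⟩ := h Nf hNf
    exact qcdOf_of_chiralCompletion hC hNf reg hms hM₀ hbody
  exact ⟨key 2 (Or.inl rfl), key 3 (Or.inr rfl)⟩

end Summit.QuantumFields.QCD.Theorems.LightQuarkJumpLine

end
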